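import Summits.QuantumFields.QCD.Theses.MultibosonBridge

/-!
# Birth skeleton for the piece `MultibosonLatticeGapR4` (stmt-QuantumFields-17617) of the split of `FullLatticeGapC` (stmt-QuantumFields-17619)

Extracted verbatim from the registered line `Cruxes/FullLatticeGapC/Lines/multiboson_split.lean` (strategist seat
`planner-cstrat-stmt-QuantumFields-17619-r1-0`, 2026-08-17) so that the piece carries ITS OWN two stubs and composition:
S1 `stub_chiralDiluteLine` (the honest chiral line with tied admissible data and a dilute tail, NO gap) and
S2 `stub_gapOfDiluteTail` (∀ reg/data: dilute tail ⇒ bosonised gap, NO chiral tuning) ⟹ `multibosonLatticeGapR4_of_stubs`.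
`lean check` rc 0 with `sorry` only inside the two `stub_*`; the composition concludes
`Summit.QuantumFields.QCD.Theses.MultibosonBridge.MultibosonLatticeGapR4` BY NAME. Card: `Lines/multiboson_split.md`.
-/

namespace Summit.QuantumFields.QCD.Cruxes.FullLatticeGapC.MultibosonSplit.BirthR4

open Literature.MathematicalPhysics.QuantumFieldTheory
open Summit.QuantumFields.QCD.Theses.MultibosonBridge (MultibosonLatticeGapR4 GapTransferR3
  FullLatticeGapC)
open Filter

/-- **S1 — the chiral dilute line (piece `MultibosonLatticeGapR4`, stub 1 of 2).** For
`N_f ∈ {2, 3}` there is ONE mass-independent regularisation with leading-log mass scaling, two-loop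
asymptotic scaling and the subsequence-stable chiral clause (for every `ε > 0` some positive mass
tuple has, eventually in `k`, a connected correlator beating every `C e^{−ε a_k n}` — the pion is
lighter than `ε`), such that at every positive mass tuple the bare masses are eventually on the
physical branch and there are TIED admissible multiboson data (`IsAdmissibleMultibosonDataR`,
`δ_k / a_k² → 0`) whose spectral tail is dilute under the bosonised measure
(`HasSpectralTailDomination`). No gap is asserted: this is the existence of the honest critical
line approached from the massive side, certified intrinsically by tail-diluteness (which fails
inside the Aoki phase and at criticality, where `ρ_H(0) ≠ 0`, and holds trivially for parked heavy
masses — but those violate the chiral clause). Why plausible: GMOR `m_π² ≈ 2Bm` on the massive side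
of `κ_c(β)` (Sharpe–Singleton scenario analysis), and at bare subtracted mass `a m_q > 0` the band
`|t| ≤ a m_q / 2.2` of `γ₅ D_W` is populated only by lattice artefacts whose density vanishes
towards the continuum (Edwards–Heller–Narayanan 1999), suppressed further by `W ≈ κ^N |det H|`.
Size: L (open). -/
theorem stub_chiralDiluteLine :
    ∀ Nf : ℕ, Nf = 2 ∨ Nf = 3 → ∃ reg : QCDRegularisation Nf, reg.HasMassScaling ∧
      (reg.scheme 0 0 0).HasAsymptoticScaling ∧
      (∀ ε : ℝ, 0 < ε → ∃ m : Fin Nf → ℝ, (∀ f, 0 < m f) ∧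
        ∃ (R R' : ℕ) (A : QCDLatticeObservable Nf R) (B : QCDLatticeObservable Nf R'),
          ∀ C : ℝ, ∀ᶠ k in atTop, ∃ S : ℕ, (reg.scheme m 0 0).L k ≤ S ∧ ∃ n : ℕ, n ≤ S ∧
            C * Real.exp (-(ε * ((reg.scheme m 0 0).a k * n))) <
              ‖qcdLatticeConnectedCorr ((reg.scheme m 0 0).β k) (2 * S + 1)
                (fun fl => (reg.scheme m 0 0).mq fl k) A B n‖) ∧
      ∀ m : Fin Nf → ℝ, (∀ f, 0 < m f) →
        (∀ f, ∀ᶠ k in atTop, -1 < (reg.scheme m 0 0).mq f k) ∧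
        ∃ (ε δ p : ℕ → ℝ) (ℓ : ℕ → ℕ) (κ : ℕ → Fin Nf → ℝ) (ν : ℕ → Fin Nf → List ℂ),
          IsAdmissibleMultibosonDataR (reg.scheme m 0 0) ε δ ℓ κ ν ∧
          Tendsto (fun k => δ k / reg.a k ^ 2) atTop (nhds 0) ∧
          HasSpectralTailDomination (reg.scheme m 0 0) ε p ℓ ν := by
  sorry

/-- **S2 — gap of the dilute-tailed bosonised theory (piece `MultibosonLatticeGapR4`, stub 2 of 2).**
Along EVERY regularisation with mass scaling and asymptotic scaling (`N_f ∈ {2,3}`), at every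
positive mass tuple eventually on the physical branch, and for EVERY tied admissible multiboson data
with a dilute spectral tail, the bosonised `SU(3)` gauge–Higgs marginal (`multibosonExpect`, weight
`W = ∏_f ∏_z |det(γ₅ D_W(m_f(k)) − z)|⁻² > 0`) has a volume-uniform lattice gap `Δ > 0`
(`HasMultibosonLatticeGap`). Universally quantified: the dilute tail is the intrinsic "massive side"
certificate (Aoki-phase / critical witnesses have `ρ_H(0) ≠ 0` and fail it; quenched data `ν = []`,
`ε ≡ 1` fail it since every vector is then a quasi-mode), so no chiral tuning enters; on parked
(cutoff-heavy) regularisations the tail is empty by coercivity and S2 reduces to the `SU(3)` lattice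
Yang–Mills gap with heavy positive-weight multiplets — S2 is at least that hard
(`PerturbativeInvisibility` conceded, as for the crux). Why plausible: positive-weight gauge–Higgs
systems are the constructive corner with probabilistic tools (Osterwalder–Seiler 1978; Bałaban's
block RG with exact Gaussian integration of the multiplets), and a dilute tail removes the only
light non-gluonic excitation besides the massive pion. Size: XL (open; Yang–Mills-hard). -/
theorem stub_gapOfDiluteTail :
    ∀ (Nf : ℕ) (reg : QCDRegularisation Nf) (m : Fin Nf → ℝ) (ε δ p : ℕ → ℝ) (ℓ : ℕ → ℕ)
      (κ : ℕ → Fin Nf → ℝ) (ν : ℕ → Fin Nf → List ℂ),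
      Nf = 2 ∨ Nf = 3 → reg.HasMassScaling → (reg.scheme 0 0 0).HasAsymptoticScaling →
      (∀ f, 0 < m f) → (∀ f, ∀ᶠ k in atTop, -1 < (reg.scheme m 0 0).mq f k) →
      IsAdmissibleMultibosonDataR (reg.scheme m 0 0) ε δ ℓ κ ν →
      Tendsto (fun k => δ k / reg.a k ^ 2) atTop (nhds 0) →
      HasSpectralTailDomination (reg.scheme m 0 0) ε p ℓ ν →
      ∃ Δ > 0, (reg.scheme m 0 0).HasMultibosonLatticeGap ν Δ := by
  sorry

/-- Piece 1 (`MultibosonLatticeGapR4`, stmt-QuantumFields-17617) from S1 and S2: instantiate S2 at the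
witnesses of S1. [folklore] -/
theorem multibosonLatticeGapR4_of_stubs : MultibosonLatticeGapR4 := by
  intro Nf hNf
  obtain ⟨reg, hms, has, hchi, hall⟩ := stub_chiralDiluteLine Nf hNf
  refine ⟨reg, hms, has, hchi, fun m hm => ?_⟩
  obtain ⟨hbr, ε, δ, p, ℓ, κ, ν, hAdm, hRate, hTail⟩ := hall m hm
  obtain ⟨Δ, hΔ, hGap⟩ :=
    stub_gapOfDiluteTail Nf reg m ε δ p ℓ κ ν hNf hms has hm hbr hAdm hRate hTail
  exact ⟨hbr, ε, δ, p, ℓ, κ, ν, hAdm, hRate, hTail, Δ, hΔ, hGap⟩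

end Summit.QuantumFields.QCD.Cruxes.FullLatticeGapC.MultibosonSplit.BirthR4
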